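import Literature.MathematicalPhysics.QuantumLattice.PeriodicRectTrialState
import Literature.MathematicalPhysics.QuantumLattice.EmeryThreeBandClusterFloor
import HarnessLib

/-!
# The three-band (Emery) CLUSTER TRIAL CAP: one even density matrix on an open `Cu_{ab}O_{2ab}` block (dummies empty, `Re tr(N ρ₀) = 4ab·ρ`)
# caps the typed three-band energy density, `emeryEnergyDensity θ ρ ≤ (4ab)⁻¹ · Re tr(H^θ_block ρ₀)`, at EVERY coupling vector `θ`

Topic `Literature/MathematicalPhysics/QuantumLattice` (family `hubbard`; crew hubbard-fast S2 (iv) «three-band Emery boxes»; the CAP half of the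
three-band energy WINDOW whose floor half is `EmeryThreeBandClusterFloor` / `…CuO4WindowFloor` / `…RingWindowFloor`). The Downfold seam
`S2SeamEmeryCaps` (hubbard-downfold-mod-4) transports a trial cap `trialCap ω₀ θ₀ θ = e_{M(θ₀)}(ω₀) + Σ_a (θ_a − θ₀_a) e_{D_a}(ω₀)` over a material's
six-box by the vertex rule — but «the trial state, its energy and conjugate densities are S2's data» and no producer existed. This file is the
PRODUCER LAW: for `m = (a−1, b−1)` and an even density matrix `ρ₀` on the aligned block `[0,2a) × [0,2b)` (`ab` decorated `CuO₂` cells; Cu on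
`(2ℤ)²`, O_x on `(1,0)+(2ℤ)²`, O_y on `(0,1)+(2ℤ)²`, dummies on `(1,1)+(2ℤ)²`), the periodic cluster trial state
`ω̃ = perRectTrialState liebPeriods m ρ₀` (`PeriodicRectTrialState`: the `(2ℤ)²`-average of `⊗_v ρ₀`) is a member of `emeryStates ρ` as soon as
`ρ₀` puts no particle on the dummy sites and `Re tr(N ρ₀) = 4ab·ρ`, and its cell energies are exact cluster traces:

* §1 STRADDLING TERMS VANISH: every sublattice hopping / on-site atom — hence every `emeryAtoms a` and `emeryInteraction θ` — has zero expectation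
  in `⊗_v ρ₀` on every shape meeting the block without lying in it (`rectTilingState_expect_sublatticeVectorHopping_eq_zero_of_straddle`, `…OnSite…`,
  `…emeryAtoms…`, `…emeryInteraction…`; general `Q`), and `(emeryAtoms a).Φ ∅ = 0`, `(emeryInteraction θ).Φ ∅ = 0`.
* §2 MEMBERSHIP: `perRectTrialState_liebPeriods_mem_emeryStates`.
* §3 EXACT CELL ENERGIES: `cellEnergy (emeryViews θ) 1 ω̃ = |block|⁻¹ · Re tr(H^θ_block ρ₀)` and, direction by direction,
  `cellEnergy (emeryDirections a) 1 ω̃ = |block|⁻¹ · Re tr(D_{a,block} ρ₀)` (`|block| = 4ab`), with `H^θ_block = Σ_a θ_a D_{a,block}`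
  (`localHamiltonian_emeryInteraction`).
* §4 **THE CAP** `emeryEnergyDensity_le_clusterTrace`: `emeryEnergyDensity θ ρ ≤ |block|⁻¹ · Re tr(H^θ_block ρ₀)` for EVERY `θ` — an affine function of
  `θ` with the fourteen slopes `|block|⁻¹ Re tr(D_{a,block} ρ₀)` (`emeryEnergyDensity_le_sum_clusterTraces`), i.e. exactly the data `S2SeamEmeryCaps.trialCap`
  asks for; a pure state `ρ₀ = |ψ⟩⟨ψ|` with rational `ψ` in a fixed `(N↑,N↓)` sector makes every trace a rational number.

Everything is PROVED (0 sorry); no definition, no named fact, no number. HONEST SCOPE: a cluster-product (Anderson-type) cap — it loses the kinetic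
energy of every bond leaving the block (`a = b = 2`: 4 of 16 Cu–O and 7 of 16 O–O bonds per block), so it is crude at small blocks; Hartree–Fock /
tensor-network trial states of the decorated lattice would be tighter and are not here.

## Tree / Mathlib search

REUSED: `perRectTrialState(_isPeriodic)`, `density_shift_perRectTrialState_eq_trace`, `cellFilling_perRectTrialState`, `cellMeanEnergy_perRectTrialState_eq`,
`alignedPeriods`, `latPt`, `card_cell_alignedPeriods` (`PeriodicRectTrialState`); `rectTilingState`, `rectTilingState_expect_creation_mul_annihilation_eq_zero`,
`cls_ne_cls_of_pair_straddle` (`FermionRectTilingProductState`, `ClusterProductStateEnergy`); `emeryStates`, `emeryEnergyDensity`, `emeryViews`,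
`emeryDirections`, `cellPos_dummy` (`EmeryThreeBandByDecoration`, `EmeryThreeBandStatesNonempty`); `emeryAtoms(_structure)`, `emeryInteraction(_structure)`,
`cellEnergy_emeryViews_eq_cellMeanEnergy`, `cellEnergy_emeryDirections_eq_cellMeanEnergy` (`EmeryThreeBandClusterFloor`); `sublatticeVectorHopping_apply_pair /
_apply_eq_zero`, `sublatticeOnSite_apply_eq_zero`, `vectorHoppingFermionInteraction_apply_pair`; `linearFamily_apply`, `localHamiltonian_linearFamily`,
`hubbardFermionInteraction_zero_zero_apply`; `infCellEnergyOn_le_cellEnergy`. `rg 'TrialCap|clusterTrace'` (QuantumLattice, 2026-08-28): nothing for the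
three-band model (`S2SeamEmeryCaps.trialCap` is the Summits-side consumer).

## References

* D. Ruelle, *Statistical Mechanics: Rigorous Results* (1969), §3.3 (cluster trial states bound the ground-state energy density from above). [cite: Ruelle1969, §3.3]
* O. Bratteli, D. W. Robinson, *OAQSM 2* (1997), Thm. 6.2.40. [cite: BratteliRobinsonII1997, Thm. 6.2.40]
* H. Araki, H. Moriya, Rev. Math. Phys. 15 (2003) 93, §4.1 eq. (4.8), §11.1 Thm. 11.2. [cite: ArakiMoriya2003, §11.1 Theorem 11.2]
* E. Pavarini et al., Phys. Rev. Lett. 87 (2001) 047003, eq. (1). [cite: PavariniEtAl2001, eq. (1)]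
-/

noncomputable section

open scoped ComplexOrder BigOperators
open Finset

namespace Literature.MathematicalPhysics.QuantumLattice

open Matrix HubbardWave0 Literature.Probability.LatticeModels ThermodynamicLimit

namespace InfVolFermionState

/-! ### §1. Straddling terms of the three-band interaction vanish in the tiling state -/

section Straddle

variable {d : ℕ} (Q : Fin d → ℕ) (ρ₀ : FermionOp (halfOpenRect Q)) (hev : parityAut ρ₀ = ρ₀) (hpsd : ρ₀.PosSemidef) (htr : ρ₀.trace = 1)

/-- **Straddling terms of a sublattice hopping atom vanish** in `⊗_v ρ₀` (a hopping word between two blocks: odd × odd).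
[cite: ArakiMoriya2003, §11.1 Theorem 11.2] -/
theorem rectTilingState_expect_sublatticeVectorHopping_eq_zero_of_straddle (q : Fin d → ℕ) (c v : Site d) (t : ℝ) {Y : Finset (Site d)}
    (hY : ¬ Y ⊆ halfOpenRect Q) (hY' : (Y ∩ halfOpenRect Q).Nonempty) :
    (rectTilingState Q ρ₀ hev hpsd htr).expect Y ((sublatticeVectorHopping q c v t).Φ Y) = 0 := by
  by_cases h : ∃ x : Site d, Y = {x, x + v}
  · obtain ⟨x, rfl⟩ := h
    by_cases hv : v = 0
    · subst hv
      obtain ⟨z, hz⟩ := hY'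
      rw [add_zero, Finset.pair_eq_singleton, Finset.mem_inter, Finset.mem_singleton] at hz
      rw [add_zero, Finset.pair_eq_singleton] at hY
      exact absurd (Finset.singleton_subset_iff.2 (hz.1 ▸ hz.2)) hY
    rw [sublatticeVectorHopping_apply_pair q c hv t x]
    by_cases hc : InCoset q c x
    · rw [if_pos hc]
      exact rectTilingState_expect_vectorHopping_eq_zero_of_straddle Q ρ₀ hev hpsd htr v t hY hY'
    · rw [if_neg hc, map_zero]
  · push Not at h
    rw [sublatticeVectorHopping_apply_eq_zero q c v t (fun x => h x), map_zero]

/-- **On-site atoms never straddle**: a singleton meeting the block lies in it. [cite: ArakiMoriya2003, §11.1 Theorem 11.2] -/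
theorem rectTilingState_expect_sublatticeOnSite_eq_zero_of_straddle (q : Fin d → ℕ) (c : Site d) (ε U : ℝ) {Y : Finset (Site d)}
    (hY : ¬ Y ⊆ halfOpenRect Q) (hY' : (Y ∩ halfOpenRect Q).Nonempty) :
    (rectTilingState Q ρ₀ hev hpsd htr).expect Y ((sublatticeOnSite q c ε U).Φ Y) = 0 := by
  by_cases h : ∃ x : Site d, Y = {x}
  · obtain ⟨x, rfl⟩ := h
    obtain ⟨z, hz⟩ := hY'
    rw [Finset.mem_inter, Finset.mem_singleton] at hz
    exact absurd (Finset.singleton_subset_iff.2 (hz.1 ▸ hz.2)) hY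
  · push Not at h
    rw [sublatticeOnSite_apply_eq_zero q c ε U (fun x => h x), map_zero]

/-- **Every Emery atom is a sublattice hopping atom or a sublattice on-site atom** (by its index). [cite: PavariniEtAl2001, eq. (1)] -/
theorem emeryAtoms_cases (a : Fin 14) :
    (∃ c v : Site 2, emeryAtoms a = sublatticeVectorHopping liebPeriods c v 1) ∨
      (∃ (c : Site 2) (ε U : ℝ), emeryAtoms a = sublatticeOnSite liebPeriods c ε U) := by
  fin_cases a
  · exact Or.inl ⟨cuSite, unitVec 0, rfl⟩
  · exact Or.inl ⟨oxSite, unitVec 0, rfl⟩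
  · exact Or.inl ⟨cuSite, unitVec 1, rfl⟩
  · exact Or.inl ⟨oySite, unitVec 1, rfl⟩
  · exact Or.inl ⟨oxSite, ppVec 0, rfl⟩
  · exact Or.inl ⟨oxSite, ppVec 1, rfl⟩
  · exact Or.inl ⟨oxSite, ppVec 2, rfl⟩
  · exact Or.inl ⟨oxSite, ppVec 3, rfl⟩
  · exact Or.inr ⟨cuSite, 1, 0, rfl⟩
  · exact Or.inr ⟨oxSite, 1, 0, rfl⟩
  · exact Or.inr ⟨oySite, 1, 0, rfl⟩
  · exact Or.inr ⟨cuSite, 0, 1, rfl⟩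
  · exact Or.inr ⟨oxSite, 0, 1, rfl⟩
  · exact Or.inr ⟨oySite, 0, 1, rfl⟩

/-- **Straddling terms of every Emery atom vanish** in `⊗_v ρ₀`. [cite: ArakiMoriya2003, §11.1 Theorem 11.2] [cite: PavariniEtAl2001, eq. (1)] -/
theorem rectTilingState_expect_emeryAtoms_eq_zero_of_straddle (Q : Fin 2 → ℕ) (ρ₀ : FermionOp (halfOpenRect Q)) (hev : parityAut ρ₀ = ρ₀)
    (hpsd : ρ₀.PosSemidef) (htr : ρ₀.trace = 1) (a : Fin 14) {Y : Finset (Site 2)}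
    (hY : ¬ Y ⊆ halfOpenRect Q) (hY' : (Y ∩ halfOpenRect Q).Nonempty) :
    (rectTilingState Q ρ₀ hev hpsd htr).expect Y ((emeryAtoms a).Φ Y) = 0 := by
  rcases emeryAtoms_cases a with ⟨c, v, h⟩ | ⟨c, ε, U, h⟩
  · rw [h]; exact rectTilingState_expect_sublatticeVectorHopping_eq_zero_of_straddle Q ρ₀ hev hpsd htr _ c v 1 hY hY'
  · rw [h]; exact rectTilingState_expect_sublatticeOnSite_eq_zero_of_straddle Q ρ₀ hev hpsd htr _ c ε U hY hY'

/-- **Straddling terms of the three-band interaction vanish** in `⊗_v ρ₀`, at every `θ`. [cite: ArakiMoriya2003, §11.1 Theorem 11.2] -/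
theorem rectTilingState_expect_emeryInteraction_eq_zero_of_straddle (Q : Fin 2 → ℕ) (ρ₀ : FermionOp (halfOpenRect Q)) (hev : parityAut ρ₀ = ρ₀)
    (hpsd : ρ₀.PosSemidef) (htr : ρ₀.trace = 1) (θ : Fin 14 → ℝ) {Y : Finset (Site 2)}
    (hY : ¬ Y ⊆ halfOpenRect Q) (hY' : (Y ∩ halfOpenRect Q).Nonempty) :
    (rectTilingState Q ρ₀ hev hpsd htr).expect Y ((emeryInteraction θ).Φ Y) = 0 := by
  rw [emeryInteraction, FermionInteraction.linearFamily_apply, hubbardFermionInteraction_zero_zero_apply, zero_add, map_sum]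
  refine Finset.sum_eq_zero fun a _ => ?_
  rw [map_smul, rectTilingState_expect_emeryAtoms_eq_zero_of_straddle Q ρ₀ hev hpsd htr a hY hY', smul_zero]

end Straddle

/-- The Emery atoms have no empty-set term. [cite: PavariniEtAl2001, eq. (1)] -/
theorem emeryAtoms_apply_empty (a : Fin 14) : (emeryAtoms a).Φ ∅ = 0 := by
  rcases emeryAtoms_cases a with ⟨c, v, h⟩ | ⟨c, ε, U, h⟩
  · rw [h]; exact sublatticeVectorHopping_apply_eq_zero _ _ _ _ (fun x h => absurd h.symm (Finset.insert_ne_empty _ _))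
  · rw [h]; exact sublatticeOnSite_apply_eq_zero _ _ _ _ (fun x h => absurd h.symm (Finset.singleton_ne_empty _))

/-- The three-band interaction has no empty-set term. [cite: PavariniEtAl2001, eq. (1)] -/
theorem emeryInteraction_apply_empty (θ : Fin 14 → ℝ) : (emeryInteraction θ).Φ ∅ = 0 := by
  rw [emeryInteraction, FermionInteraction.linearFamily_apply, hubbardFermionInteraction_zero_zero_apply, zero_add]
  exact Finset.sum_eq_zero fun a _ => by rw [emeryAtoms_apply_empty, smul_zero]

/-- **The block Hamiltonian of the three-band interaction is linear in the couplings**: `H^θ_B = Σ_a θ_a D_{a,B}`. [cite: PavariniEtAl2001, eq. (1)] -/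
theorem localHamiltonian_emeryInteraction (θ : Fin 14 → ℝ) (B : Finset (Site 2)) :
    (emeryInteraction θ).localHamiltonian B = ∑ a, ((θ a : ℝ) : ℂ) • (emeryAtoms a).localHamiltonian B := by
  rw [emeryInteraction, FermionInteraction.localHamiltonian_linearFamily]
  have h0 : (hubbardFermionInteraction 2 0 0).localHamiltonian B = 0 := by
    unfold FermionInteraction.localHamiltonian
    exact Finset.sum_eq_zero fun X _ => by rw [hubbardFermionInteraction_zero_zero_apply, map_zero]
  rw [h0, zero_add]

/-! ### §2. The Emery cluster trial state is a member of the variational class -/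

section Emery

variable (m : Fin 2 → ℕ) (ρ₀ : FermionOp (halfOpenRect (alignedPeriods liebPeriods m))) (hev : parityAut ρ₀ = ρ₀) (hpsd : ρ₀.PosSemidef)
  (htr : ρ₀.trace = 1)

/-- The block has `4·|Cell m|` sites (`|Cell m| = ab` decorated cells of four sites each). [cite: ArakiMoriya2003, §4.1 Def. 4.3] -/
theorem card_cell_alignedPeriods_liebPeriods : Fintype.card (Cell (alignedPeriods liebPeriods m)) = 4 * Fintype.card (Cell m) := by
  rw [card_cell_alignedPeriods, Fintype.card_pi, Fin.prod_univ_two, Fintype.card_fin, Fintype.card_fin]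
  rfl

/-- **MEMBERSHIP.** If `ρ₀` puts no particle on any dummy site of the block (`Re tr((n_{y↑}+n_{y↓})ρ₀) = 0`, `y = (1,1) + ℓ(pos k)`) and
`Re tr(N ρ₀) = 4·|Cell m|·ρ`, then the periodic cluster trial state lies in `emeryStates ρ`. [cite: BratteliRobinsonII1997, Thm. 6.2.40] -/
theorem perRectTrialState_liebPeriods_mem_emeryStates {ρ : ℝ}
    (hdummy : ∀ k : Cell m,
      (((nAt (cellPos (fun i => Fin.last (liebPeriods i) : Cell liebPeriods) + latPt liebPeriods m k)
            (cellPos_add_latPt_mem_halfOpenRect liebPeriods m _ k) 0 +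
          nAt (cellPos (fun i => Fin.last (liebPeriods i) : Cell liebPeriods) + latPt liebPeriods m k)
            (cellPos_add_latPt_mem_halfOpenRect liebPeriods m _ k) 1) * ρ₀).trace).re = 0)
    (hN : ((totalNumber : FermionOp (halfOpenRect (alignedPeriods liebPeriods m))) * ρ₀).trace.re = 4 * Fintype.card (Cell m) * ρ) :
    perRectTrialState liebPeriods m ρ₀ hev hpsd htr ∈ emeryStates ρ := by
  refine ⟨perRectTrialState_isPeriodic _ _ _ _ _ _, ?_, ?_⟩
  · rw [← cellPos_dummy, density_shift_perRectTrialState_eq_trace]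
    rw [Finset.sum_eq_zero fun k _ => hdummy k, mul_zero]
  · rw [cellFilling_perRectTrialState, hN, card_cell_alignedPeriods_liebPeriods]
    have hK : (Fintype.card (Cell m) : ℝ) ≠ 0 := Nat.cast_ne_zero.2 Fintype.card_ne_zero
    push_cast
    field_simp

/-! ### §3. Exact cell energies of the trial state -/

/-- **The cell energy of the views at `θ` is the block trace**: `cellEnergy (emeryViews θ) 1 ω̃ = |block|⁻¹ · Re tr(H^θ_block ρ₀)`.
[cite: BratteliRobinsonII1997, Thm. 6.2.40] [cite: Ruelle1969, §3.3] -/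
theorem cellEnergy_emeryViews_perRectTrialState (θ : Fin 14 → ℝ) :
    (perRectTrialState liebPeriods m ρ₀ hev hpsd htr).cellEnergy (emeryViews θ) 1 =
      (Fintype.card (Cell (alignedPeriods liebPeriods m)) : ℝ)⁻¹ *
        ((emeryInteraction θ).localHamiltonian (halfOpenRect (alignedPeriods liebPeriods m)) * ρ₀).trace.re := by
  rw [cellEnergy_emeryViews_eq_cellMeanEnergy,
    cellMeanEnergy_perRectTrialState_eq liebPeriods m ρ₀ hev hpsd htr (emeryInteraction_structure θ).2.2.1 (emeryInteraction_structure θ).2.2.2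
      (fun Y hY hY' => rectTilingState_expect_emeryInteraction_eq_zero_of_straddle _ ρ₀ hev hpsd htr θ hY hY'),
    emeryInteraction_apply_empty, map_zero, sub_zero]

/-- **The cell energy of each direction is the block trace of that atom**: `cellEnergy (emeryDirections a) 1 ω̃ = |block|⁻¹ · Re tr(D_{a,block} ρ₀)` —
the fourteen conjugate densities of the trial state (bond energies, site occupations, double occupancies per cell). [cite: BratteliRobinsonII1997, Thm. 6.2.40] -/
theorem cellEnergy_emeryDirections_perRectTrialState (a : Fin 14) :
    (perRectTrialState liebPeriods m ρ₀ hev hpsd htr).cellEnergy (emeryDirections a) 1 =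
      (Fintype.card (Cell (alignedPeriods liebPeriods m)) : ℝ)⁻¹ *
        ((emeryAtoms a).localHamiltonian (halfOpenRect (alignedPeriods liebPeriods m)) * ρ₀).trace.re := by
  rw [cellEnergy_emeryDirections_eq_cellMeanEnergy,
    cellMeanEnergy_perRectTrialState_eq liebPeriods m ρ₀ hev hpsd htr (emeryAtoms_structure a).2.2.1 (emeryAtoms_structure a).2.2.2
      (fun Y hY hY' => rectTilingState_expect_emeryAtoms_eq_zero_of_straddle _ ρ₀ hev hpsd htr a hY hY'),
    emeryAtoms_apply_empty, map_zero, sub_zero]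

/-! ### §4. The cap -/

include hev hpsd htr in
/-- **THE THREE-BAND CLUSTER TRIAL CAP.** For an even density matrix `ρ₀` on the open block `[0,2a)×[0,2b)` of the decorated `CuO₂` lattice with no
particle on the dummy sites and `Re tr(N ρ₀) = 4ab·ρ`: `emeryEnergyDensity θ ρ ≤ (4ab)⁻¹ · Re tr(H^θ_block ρ₀)` at EVERY coupling vector `θ`.
[cite: Ruelle1969, §3.3] [cite: BratteliRobinsonII1997, Thm. 6.2.40] -/
theorem emeryEnergyDensity_le_clusterTrace {ρ : ℝ}
    (hdummy : ∀ k : Cell m,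
      (((nAt (cellPos (fun i => Fin.last (liebPeriods i) : Cell liebPeriods) + latPt liebPeriods m k)
            (cellPos_add_latPt_mem_halfOpenRect liebPeriods m _ k) 0 +
          nAt (cellPos (fun i => Fin.last (liebPeriods i) : Cell liebPeriods) + latPt liebPeriods m k)
            (cellPos_add_latPt_mem_halfOpenRect liebPeriods m _ k) 1) * ρ₀).trace).re = 0)
    (hN : ((totalNumber : FermionOp (halfOpenRect (alignedPeriods liebPeriods m))) * ρ₀).trace.re = 4 * Fintype.card (Cell m) * ρ)
    (θ : Fin 14 → ℝ) :
    emeryEnergyDensity θ ρ ≤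
      (Fintype.card (Cell (alignedPeriods liebPeriods m)) : ℝ)⁻¹ *
        ((emeryInteraction θ).localHamiltonian (halfOpenRect (alignedPeriods liebPeriods m)) * ρ₀).trace.re := by
  rw [← cellEnergy_emeryViews_perRectTrialState m ρ₀ hev hpsd htr θ, emeryEnergyDensity]
  exact infCellEnergyOn_le_cellEnergy _ 1 (perRectTrialState_liebPeriods_mem_emeryStates m ρ₀ hev hpsd htr hdummy hN)

include hev hpsd htr in
/-- **THE CAP AS AN AFFINE FUNCTION OF THE COUPLINGS**: `emeryEnergyDensity θ ρ ≤ |block|⁻¹ Σ_a θ_a · Re tr(D_{a,block} ρ₀)` — fourteen cluster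
traces of ONE state cap the three-band energy on every coupling box (maximum at a vertex, `S2SeamEmeryCaps`). [cite: Ruelle1969, §3.3] -/
theorem emeryEnergyDensity_le_sum_clusterTraces {ρ : ℝ}
    (hdummy : ∀ k : Cell m,
      (((nAt (cellPos (fun i => Fin.last (liebPeriods i) : Cell liebPeriods) + latPt liebPeriods m k)
            (cellPos_add_latPt_mem_halfOpenRect liebPeriods m _ k) 0 +
          nAt (cellPos (fun i => Fin.last (liebPeriods i) : Cell liebPeriods) + latPt liebPeriods m k)
            (cellPos_add_latPt_mem_halfOpenRect liebPeriods m _ k) 1) * ρ₀).trace).re = 0)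
    (hN : ((totalNumber : FermionOp (halfOpenRect (alignedPeriods liebPeriods m))) * ρ₀).trace.re = 4 * Fintype.card (Cell m) * ρ)
    (θ : Fin 14 → ℝ) :
    emeryEnergyDensity θ ρ ≤
      (Fintype.card (Cell (alignedPeriods liebPeriods m)) : ℝ)⁻¹ *
        ∑ a, θ a * ((emeryAtoms a).localHamiltonian (halfOpenRect (alignedPeriods liebPeriods m)) * ρ₀).trace.re := by
  have h := emeryEnergyDensity_le_clusterTrace m ρ₀ hev hpsd htr hdummy hN θ
  rw [localHamiltonian_emeryInteraction, Finset.sum_mul, Matrix.trace_sum, Complex.re_sum] at h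
  simp only [Matrix.smul_mul, Matrix.trace_smul, smul_eq_mul, Complex.re_ofReal_mul] at h
  exact h

/-- **The trial cap of the seam, evaluated**: with `ω̃` the cluster trial state, mod-4's `trialCap ω̃ θ₀ θ = e_{M(θ₀)}(ω̃) + Σ_a (θ_a − θ₀_a) e_{D_a}(ω̃)`
equals `|block|⁻¹ Σ_a θ_a Re tr(D_{a,block} ρ₀)` for every anchor `θ₀`. [cite: KomaTasaki1994, §1] -/
theorem cellEnergy_emeryViews_add_sum_perRectTrialState (θ₀ θ : Fin 14 → ℝ) :
    (perRectTrialState liebPeriods m ρ₀ hev hpsd htr).cellEnergy (emeryViews θ₀) 1 +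
        ∑ a, (θ a - θ₀ a) * (perRectTrialState liebPeriods m ρ₀ hev hpsd htr).cellEnergy (emeryDirections a) 1 =
      (Fintype.card (Cell (alignedPeriods liebPeriods m)) : ℝ)⁻¹ *
        ∑ a, θ a * ((emeryAtoms a).localHamiltonian (halfOpenRect (alignedPeriods liebPeriods m)) * ρ₀).trace.re := by
  rw [cellEnergy_emeryViews_perRectTrialState, localHamiltonian_emeryInteraction, Finset.sum_mul, Matrix.trace_sum, Complex.re_sum]
  simp only [cellEnergy_emeryDirections_perRectTrialState, Matrix.smul_mul, Matrix.trace_smul, smul_eq_mul, Complex.re_ofReal_mul]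
  rw [Finset.mul_sum, Finset.mul_sum, ← Finset.sum_add_distrib]
  refine Finset.sum_congr rfl fun a _ => ?_
  ring

end Emery

end InfVolFermionState

end Literature.MathematicalPhysics.QuantumLattice

end
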